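import Literature.AlgebraicGeometry.Hu2025.Statements.S03Pluecker.R101bPrimary
import Mathlib.Tactic.IntervalCases
import HarnessLib

/-!
# Hu 2025 §3.2 — DISCHARGE of the row-101b sic pair (keyTrick1)–(keyTrick4): `C17L116` AS PRINTED fails on every rank-0 index
# (the printed recipe `h = (u₂u₃)`, `k = (u₁123)` vanishes identically when `u₁ ∈ {1,2,3}`), `C17L116_ours` HOLDS for every
# `u ∈ 𝕀^lt_{3,n}`, `Rem3_10` HOLDS, `Ex3_2` HOLDS — kernel certificates for the T5 reading of row 101 (typer res-type-009)

**HONEST FRAMING (D-0012/D-0089).** These are theorems about OUR typed transcriptions (`keyTrickRel`, `keyTrickRel_ours`, `primaryRel`,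
`plRel`, `rkF` of `Statements/S03Pluecker/R101aPlatform.lean` · `R101bPrimary.lean`); the preprint [Hu2025] stays «under review»; a
`_holds` theorem certifies that the typed Prop is true AS TYPED, a `not_` theorem that it is false AS TYPED — which is exactly what the
`-- sic` annotation of `C17L116` records (the compact recipe with `u₁ = min u` degenerates for `u = (1uv), (2uv), (3uv)`, while the
four explicit printed forms — the paper's working definition, §3.5 — are reproduced by the evident correction). No claim beyond the
kernel; AI proof is weaker than expert review; nothing here is progress on resolution of singularities.

## Contents
* §1 evaluation of the signed lookup `pCoord k a b c` on the six orderings of `a < b < c` and on repeated indices;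
* §2 `keyTrickRel_eq_zero_of_le_three` — AS PRINTED the recipe gives `0` for `u₁ ≤ 3`; hence `not_C17L116` for `n ≥ 5` (witness
  `u = (1,4,5)`, where `primaryRel ≠ 0`);
* §3 `C17L116_ours_holds` — the corrected recipe equals the explicit form for every `u ∈ 𝕀^lt_{3,n}` (four cases `u₁ = 1, 2, 3, > 3`);
* §4 `Rem3_10_holds`, `Ex3_2_holds`.
-/

noncomputable section

namespace Literature.AlgebraicGeometry.Hu2025.Statements.S03Pluecker

open MvPolynomial

universe u

variable {n : ℕ} (k : Type u) [CommRing k]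

/-! ## §1 The signed lookup on permutations of an increasing triple -/

section PCoord

variable {a b c : ℕ}

/-- `p_{abc} = p_{(a,b,c)}` for `a < b < c`.
[cite: Hu2025, (keyTrick) = (3.6)–(3.8) p.36 l.7–38; Ex. 3.2 p.34 l.23–27; Rem. 3.10 p.40 l.48–60 (unrefereed preprint arXiv:2507.21400v1 under adjudication, D-0012/D-0089
— kernel support on OUR typed carriers of row 101; nothing of the source asserted)] -/
theorem pCoord_abc (hab : a < b) (hbc : b < c) : (pCoord k a b c : PlRing n k) = pTri k (a, b, c) := by
  have h1 : sort3 a b c = (a, b, c) := by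
    unfold sort3; ext <;> simp only [] <;> omega
  have h2 : inv3 a b c = 0 := by unfold inv3; rw [if_neg (by omega), if_neg (by omega), if_neg (by omega)]
  rw [pCoord, h1, h2, pow_zero, one_mul]

/-- `p_{acb} = −p_{(a,b,c)}` for `a < b < c`.
[cite: Hu2025, (keyTrick) = (3.6)–(3.8) p.36 l.7–38; Ex. 3.2 p.34 l.23–27; Rem. 3.10 p.40 l.48–60 (unrefereed preprint arXiv:2507.21400v1 under adjudication, D-0012/D-0089
— kernel support on OUR typed carriers of row 101; nothing of the source asserted)] -/
theorem pCoord_acb (hab : a < b) (hbc : b < c) : (pCoord k a c b : PlRing n k) = -pTri k (a, b, c) := by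
  have h1 : sort3 a c b = (a, b, c) := by
    unfold sort3; ext <;> simp only [] <;> omega
  have h2 : inv3 a c b = 1 := by unfold inv3; rw [if_neg (by omega), if_neg (by omega), if_pos (by omega)]
  rw [pCoord, h1, h2, pow_one, neg_one_mul]

/-- `p_{bac} = −p_{(a,b,c)}` for `a < b < c`.
[cite: Hu2025, (keyTrick) = (3.6)–(3.8) p.36 l.7–38; Ex. 3.2 p.34 l.23–27; Rem. 3.10 p.40 l.48–60 (unrefereed preprint arXiv:2507.21400v1 under adjudication, D-0012/D-0089
— kernel support on OUR typed carriers of row 101; nothing of the source asserted)] -/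
theorem pCoord_bac (hab : a < b) (hbc : b < c) : (pCoord k b a c : PlRing n k) = -pTri k (a, b, c) := by
  have h1 : sort3 b a c = (a, b, c) := by
    unfold sort3; ext <;> simp only [] <;> omega
  have h2 : inv3 b a c = 1 := by unfold inv3; rw [if_pos (by omega), if_neg (by omega), if_neg (by omega)]
  rw [pCoord, h1, h2, pow_one, neg_one_mul]

/-- `p_{bca} = p_{(a,b,c)}` for `a < b < c` (even permutation).
[cite: Hu2025, (keyTrick) = (3.6)–(3.8) p.36 l.7–38; Ex. 3.2 p.34 l.23–27; Rem. 3.10 p.40 l.48–60 (unrefereed preprint arXiv:2507.21400v1 under adjudication, D-0012/D-0089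
— kernel support on OUR typed carriers of row 101; nothing of the source asserted)] -/
theorem pCoord_bca (hab : a < b) (hbc : b < c) : (pCoord k b c a : PlRing n k) = pTri k (a, b, c) := by
  have h1 : sort3 b c a = (a, b, c) := by
    unfold sort3; ext <;> simp only [] <;> omega
  have h2 : inv3 b c a = 2 := by unfold inv3; rw [if_neg (by omega), if_pos (by omega), if_pos (by omega)]
  rw [pCoord, h1, h2]
  ring

/-- `p_{cab} = p_{(a,b,c)}` for `a < b < c` (even permutation).
[cite: Hu2025, (keyTrick) = (3.6)–(3.8) p.36 l.7–38; Ex. 3.2 p.34 l.23–27; Rem. 3.10 p.40 l.48–60 (unrefereed preprint arXiv:2507.21400v1 under adjudication, D-0012/D-0089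
— kernel support on OUR typed carriers of row 101; nothing of the source asserted)] -/
theorem pCoord_cab (hab : a < b) (hbc : b < c) : (pCoord k c a b : PlRing n k) = pTri k (a, b, c) := by
  have h1 : sort3 c a b = (a, b, c) := by
    unfold sort3; ext <;> simp only [] <;> omega
  have h2 : inv3 c a b = 2 := by unfold inv3; rw [if_pos (by omega), if_pos (by omega), if_neg (by omega)]
  rw [pCoord, h1, h2]
  ring

/-- `p_{cba} = −p_{(a,b,c)}` for `a < b < c`.
[cite: Hu2025, (keyTrick) = (3.6)–(3.8) p.36 l.7–38; Ex. 3.2 p.34 l.23–27; Rem. 3.10 p.40 l.48–60 (unrefereed preprint arXiv:2507.21400v1 under adjudication, D-0012/D-0089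
— kernel support on OUR typed carriers of row 101; nothing of the source asserted)] -/
theorem pCoord_cba (hab : a < b) (hbc : b < c) : (pCoord k c b a : PlRing n k) = -pTri k (a, b, c) := by
  have h1 : sort3 c b a = (a, b, c) := by
    unfold sort3; ext <;> simp only [] <;> omega
  have h2 : inv3 c b a = 3 := by unfold inv3; rw [if_pos (by omega), if_pos (by omega), if_pos (by omega)]
  rw [pCoord, h1, h2]
  ring

/-- A repeated index gives `0`: `p_{aab} = 0`.
[cite: Hu2025, (keyTrick) = (3.6)–(3.8) p.36 l.7–38; Ex. 3.2 p.34 l.23–27; Rem. 3.10 p.40 l.48–60 (unrefereed preprint arXiv:2507.21400v1 under adjudication, D-0012/D-0089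
— kernel support on OUR typed carriers of row 101; nothing of the source asserted)] -/
theorem pCoord_aab (a b : ℕ) : (pCoord k a a b : PlRing n k) = 0 := by
  have h0 : (pTri k (sort3 a a b) : PlRing n k) = 0 := by
    unfold pTri
    rw [dif_neg]
    unfold sort3 plIndexSet
    simp only [Finset.mem_filter, Finset.mem_product, Finset.mem_Icc, not_and, not_lt]
    intros; omega
  rw [pCoord, h0, mul_zero]

/-- `p_{aba} = 0`.
[cite: Hu2025, (keyTrick) = (3.6)–(3.8) p.36 l.7–38; Ex. 3.2 p.34 l.23–27; Rem. 3.10 p.40 l.48–60 (unrefereed preprint arXiv:2507.21400v1 under adjudication, D-0012/D-0089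
— kernel support on OUR typed carriers of row 101; nothing of the source asserted)] -/
theorem pCoord_aba (a b : ℕ) : (pCoord k a b a : PlRing n k) = 0 := by
  have h0 : (pTri k (sort3 a b a) : PlRing n k) = 0 := by
    unfold pTri
    rw [dif_neg]
    unfold sort3 plIndexSet
    simp only [Finset.mem_filter, Finset.mem_product, Finset.mem_Icc, not_and, not_lt]
    intros; omega
  rw [pCoord, h0, mul_zero]

/-- `p_{baa} = 0`.
[cite: Hu2025, (keyTrick) = (3.6)–(3.8) p.36 l.7–38; Ex. 3.2 p.34 l.23–27; Rem. 3.10 p.40 l.48–60 (unrefereed preprint arXiv:2507.21400v1 under adjudication, D-0012/D-0089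
— kernel support on OUR typed carriers of row 101; nothing of the source asserted)] -/
theorem pCoord_baa (a b : ℕ) : (pCoord k b a a : PlRing n k) = 0 := by
  have h0 : (pTri k (sort3 b a a) : PlRing n k) = 0 := by
    unfold pTri
    rw [dif_neg]
    unfold sort3 plIndexSet
    simp only [Finset.mem_filter, Finset.mem_product, Finset.mem_Icc, not_and, not_lt]
    intros; omega
  rw [pCoord, h0, mul_zero]

end PCoord

/-! ## §2 AS PRINTED: the recipe (keyTrick1) vanishes for `u₁ ≤ 3` -/

/-- The (keyTrick1) relation `F_{(u₂u₃),(u₁123)}` is identically `0` whenever `u₁ ∈ {1,2,3}` (the index sequence `(u₁123)` repeats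
`u₁`; (signConvention) p0016 l.98–105).
[cite: Hu2025, (keyTrick) = (3.6)–(3.8) p.36 l.7–38; Ex. 3.2 p.34 l.23–27; Rem. 3.10 p.40 l.48–60 (unrefereed preprint arXiv:2507.21400v1 under adjudication, D-0012/D-0089
— kernel support on OUR typed carriers of row 101; nothing of the source asserted)] -/
theorem keyTrickRel_eq_zero_of_le_three (u : ℕ × ℕ × ℕ) (h1 : 1 ≤ u.1) (h3 : u.1 ≤ 3) : keyTrickRel n k u = 0 := by
  obtain ⟨u₁, u₂, u₃⟩ := u
  simp only at h1 h3
  unfold keyTrickRel plRel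
  simp only
  have h123 : (pCoord k 1 2 3 : PlRing n k) = pTri k (1, 2, 3) := pCoord_abc k (by norm_num) (by norm_num)
  interval_cases u₁
  · rw [pCoord_aab k 1 3, pCoord_aab k 1 2]; ring
  · rw [pCoord_aab k 2 3, pCoord_aba k 2 1, h123, pCoord_bac k (a := 1) (b := 2) (c := 3) (by norm_num) (by norm_num)]
    ring
  · rw [pCoord_aba k 3 2, pCoord_aba k 3 1, h123, pCoord_cab k (a := 1) (b := 2) (c := 3) (by norm_num) (by norm_num)]
    ring

/-- The leading coefficient test: `primaryRel (1,4,5)` has coefficient `1` at the monomial `p_{(1,4,5)} p_{(1,2,3)}` — in particular it is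
not `0` over a nontrivial ring (used for `not_C17L116`). Stated as non-vanishing.
[cite: Hu2025, (keyTrick) = (3.6)–(3.8) p.36 l.7–38; Ex. 3.2 p.34 l.23–27; Rem. 3.10 p.40 l.48–60 (unrefereed preprint arXiv:2507.21400v1 under adjudication, D-0012/D-0089
— kernel support on OUR typed carriers of row 101; nothing of the source asserted)] -/
theorem primaryRel_one_four_five_ne_zero [Nontrivial k] (hn : 5 ≤ n) : primaryRel n k (1, 4, 5) ≠ 0 := by
  have hlt : IsLt ((1 : ℕ), (4 : ℕ), (5 : ℕ)) := by unfold IsLt triSet mSet; decide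
  have m145 : ((1 : ℕ), (4 : ℕ), (5 : ℕ)) ∈ plIndexSet n := by
    unfold plIndexSet; simp only [Finset.mem_filter, Finset.mem_product, Finset.mem_Icc]; omega
  have m123 : ((1 : ℕ), (2 : ℕ), (3 : ℕ)) ∈ plIndexSet n := by
    unfold plIndexSet; simp only [Finset.mem_filter, Finset.mem_product, Finset.mem_Icc]; omega
  have m124 : ((1 : ℕ), (2 : ℕ), (4 : ℕ)) ∈ plIndexSet n := by
    unfold plIndexSet; simp only [Finset.mem_filter, Finset.mem_product, Finset.mem_Icc]; omega
  have m135 : ((1 : ℕ), (3 : ℕ), (5 : ℕ)) ∈ plIndexSet n := by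
    unfold plIndexSet; simp only [Finset.mem_filter, Finset.mem_product, Finset.mem_Icc]; omega
  have m134 : ((1 : ℕ), (3 : ℕ), (4 : ℕ)) ∈ plIndexSet n := by
    unfold plIndexSet; simp only [Finset.mem_filter, Finset.mem_product, Finset.mem_Icc]; omega
  have m125 : ((1 : ℕ), (2 : ℕ), (5 : ℕ)) ∈ plIndexSet n := by
    unfold plIndexSet; simp only [Finset.mem_filter, Finset.mem_product, Finset.mem_Icc]; omega
  have e : primaryRel n k (1, 4, 5) =
      X ⟨_, m145⟩ * X ⟨_, m123⟩ - X ⟨_, m124⟩ * X ⟨_, m135⟩ + X ⟨_, m134⟩ * X ⟨_, m125⟩ := by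
    simp only [primaryRel, primaryTerms, if_pos hlt, if_true, List.map, List.sum_cons, List.sum_nil, mTri, pTri,
      dif_pos m145, dif_pos m123, dif_pos m124, dif_pos m135, dif_pos m134, dif_pos m125]
    push_cast
    ring
  intro h0
  -- evaluate the coefficient at the monomial `p_{145} p_{123}`
  have hc := congrArg (coeff (Finsupp.single ⟨_, m145⟩ 1 + Finsupp.single ⟨_, m123⟩ 1)) (e.symm.trans h0)
  rw [coeff_zero, coeff_add, coeff_sub, X, X, X, X, X, X, monomial_mul, monomial_mul, monomial_mul,
    coeff_monomial, coeff_monomial, coeff_monomial, if_pos rfl] at hc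
  rw [if_neg, if_neg] at hc
  · norm_num at hc
  · intro h
    have := Finsupp.ext_iff.mp h ⟨_, m134⟩
    simp at this
  · intro h
    have := Finsupp.ext_iff.mp h ⟨_, m124⟩
    simp at this

/-- **`C17L116` AS PRINTED is false as typed** (for `n ≥ 5`, nontrivial `k`): at `u = (1,4,5) ∈ 𝕀^lt` the recipe gives `0`, the
explicit form does not. This is the content of the `-- sic` on `keyTrickRel` / `C17L116`.
[cite: Hu2025, (keyTrick) = (3.6)–(3.8) p.36 l.7–38; Ex. 3.2 p.34 l.23–27; Rem. 3.10 p.40 l.48–60 (unrefereed preprint arXiv:2507.21400v1 under adjudication, D-0012/D-0089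
— kernel support on OUR typed carriers of row 101; nothing of the source asserted)] -/
theorem not_C17L116 [Nontrivial k] (hn : 5 ≤ n) : ¬ C17L116 n k := by
  intro h
  have m145 : ((1 : ℕ), (4 : ℕ), (5 : ℕ)) ∈ plIndexSet n := by
    unfold plIndexSet; simp only [Finset.mem_filter, Finset.mem_product, Finset.mem_Icc]; omega
  have hlt : IsLt ((1 : ℕ), (4 : ℕ), (5 : ℕ)) := by unfold IsLt triSet mSet; decide
  have h1 := h ⟨_, m145⟩ hlt
  rw [keyTrickRel_eq_zero_of_le_three k _ (by norm_num) (by norm_num)] at h1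
  exact primaryRel_one_four_five_ne_zero k hn h1.symm

/-! ## §3 OURS: the corrected recipe reproduces the four explicit forms for every `u ∈ 𝕀^lt_{3,n}` -/

/-- Unfolding `primaryRel` on the four index shapes.
[cite: Hu2025, (keyTrick) = (3.6)–(3.8) p.36 l.7–38; Ex. 3.2 p.34 l.23–27; Rem. 3.10 p.40 l.48–60 (unrefereed preprint arXiv:2507.21400v1 under adjudication, D-0012/D-0089
— kernel support on OUR typed carriers of row 101; nothing of the source asserted)] -/
theorem primaryRel_eq (u : ℕ × ℕ × ℕ) (hlt : IsLt u) :
    primaryRel n k u =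
      if u.1 = 1 then pTri k u * pTri k mTri - pTri k (1, 2, u.2.1) * pTri k (1, 3, u.2.2) + pTri k (1, 3, u.2.1) * pTri k (1, 2, u.2.2)
      else if u.1 = 2 then pTri k u * pTri k mTri - pTri k (1, 2, u.2.1) * pTri k (2, 3, u.2.2) + pTri k (2, 3, u.2.1) * pTri k (1, 2, u.2.2)
      else if u.1 = 3 then pTri k u * pTri k mTri - pTri k (1, 3, u.2.1) * pTri k (2, 3, u.2.2) + pTri k (2, 3, u.2.1) * pTri k (1, 3, u.2.2)
      else pTri k u * pTri k mTri - pTri k (1, 2, u.1) * pTri k (3, u.2.1, u.2.2) + pTri k (1, 3, u.1) * pTri k (2, u.2.1, u.2.2)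
        - pTri k (2, 3, u.1) * pTri k (1, u.2.1, u.2.2) := by
  unfold primaryRel primaryTerms
  rw [if_pos hlt]
  split_ifs <;> simp only [List.map, List.sum_cons, List.sum_nil] <;> push_cast <;> ring

/-- For `u = (u₁,u₂,u₃) ∈ 𝕀_{3,n}` with `u ∈ 𝕀^lt`: `3 < u₂` (the two largest entries lie outside `m = {1,2,3}`).
[cite: Hu2025, (keyTrick) = (3.6)–(3.8) p.36 l.7–38; Ex. 3.2 p.34 l.23–27; Rem. 3.10 p.40 l.48–60 (unrefereed preprint arXiv:2507.21400v1 under adjudication, D-0012/D-0089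
— kernel support on OUR typed carriers of row 101; nothing of the source asserted)] -/
theorem three_lt_of_isLt {u : ℕ × ℕ × ℕ} (hu : u ∈ plIndexSet n) (hlt : IsLt u) : 3 < u.2.1 := by
  obtain ⟨u₁, u₂, u₃⟩ := u
  unfold plIndexSet at hu
  simp only [Finset.mem_filter, Finset.mem_product, Finset.mem_Icc] at hu
  by_contra hle
  rw [not_lt] at hle
  simp only at hle
  -- then `u₁ < u₂ ≤ 3`, so `u₁, u₂ ∈ {1,2,3}` and `|u ∖ m| ≤ 1`
  unfold IsLt triSet mSet at hlt
  have hsub : (({u₁, u₂, u₃} : Finset ℕ) \ {1, 2, 3}) ⊆ {u₃} := by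
    intro x hx
    simp only [Finset.mem_sdiff, Finset.mem_insert, Finset.mem_singleton, not_or] at hx
    simp only [Finset.mem_singleton]
    omega
  have := (Finset.card_le_card hsub).trans (Finset.card_singleton u₃).le
  simp only at hlt
  omega

/-- **`C17L116_ours` HOLDS**: for every `u ∈ 𝕀^lt_{3,n}` the corrected (keyTrick1) relation IS the explicit primary relation `F_{m,u}`
(four cases `u₁ = 1, 2, 3` — recipe `h = (u₁u₂)`, `k = (u₃123)` — and `u₁ > 3` — the printed `h = (u₂u₃)`, `k = (u₁123)`).
[cite: Hu2025, (keyTrick) = (3.6)–(3.8) p.36 l.7–38; Ex. 3.2 p.34 l.23–27; Rem. 3.10 p.40 l.48–60 (unrefereed preprint arXiv:2507.21400v1 under adjudication, D-0012/D-0089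
— kernel support on OUR typed carriers of row 101; nothing of the source asserted)] -/
theorem C17L116_ours_holds : C17L116_ours n k := by
  intro u hlt
  obtain ⟨⟨u₁, u₂, u₃⟩, hu⟩ := u
  have h3 : 3 < u₂ := three_lt_of_isLt (n := n) hu hlt
  unfold plIndexSet at hu
  simp only [Finset.mem_filter, Finset.mem_product, Finset.mem_Icc] at hu
  obtain ⟨⟨⟨h1a, h1b⟩, ⟨h2a, h2b⟩, ⟨h3a, h3b⟩⟩, h12, h23⟩ := hu
  rw [primaryRel_eq k _ hlt]
  unfold keyTrickRel_ours plRel mSet mTri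
  simp only [Finset.mem_insert, Finset.mem_singleton]
  have h123 : (pCoord k 1 2 3 : PlRing n k) = pTri k (1, 2, 3) := pCoord_abc k (by norm_num) (by norm_num)
  by_cases e1 : u₁ = 1
  · subst e1
    simp only [true_or, if_true]
    rw [pCoord_abc k (a := 1) (b := u₂) (c := u₃) h12 h23, h123, pCoord_aba k 1 u₂,
      pCoord_acb k (a := 1) (b := 2) (c := u₂) (by norm_num) (by omega),
      pCoord_cab k (a := 1) (b := 3) (c := u₃) (by norm_num) (by omega),
      pCoord_acb k (a := 1) (b := 3) (c := u₂) (by norm_num) h3,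
      pCoord_cab k (a := 1) (b := 2) (c := u₃) (by norm_num) (by omega)]
    ring
  by_cases e2 : u₁ = 2
  · subst e2
    simp only [true_or, or_true, if_true]
    rw [if_neg (show (2 : ℕ) ≠ 1 by decide)]
    rw [pCoord_abc k (a := 2) (b := u₂) (c := u₃) h12 h23, h123,
      pCoord_bca k (a := 1) (b := 2) (c := u₂) (by norm_num) (by omega),
      pCoord_cab k (a := 2) (b := 3) (c := u₃) (by norm_num) (by omega), pCoord_aba k 2 u₂,
      pCoord_acb k (a := 2) (b := 3) (c := u₂) (by norm_num) h3,
      pCoord_cab k (a := 1) (b := 2) (c := u₃) (by norm_num) (by omega)]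
    ring
  by_cases e3 : u₁ = 3
  · subst e3
    simp only [or_true, if_true]
    rw [if_neg (show (3 : ℕ) ≠ 1 by decide), if_neg (show (3 : ℕ) ≠ 2 by decide)]
    rw [pCoord_abc k (a := 3) (b := u₂) (c := u₃) h12 h23, h123,
      pCoord_bca k (a := 1) (b := 3) (c := u₂) (by norm_num) (by omega),
      pCoord_cab k (a := 2) (b := 3) (c := u₃) (by norm_num) (by omega),
      pCoord_bca k (a := 2) (b := 3) (c := u₂) (by norm_num) (by omega),
      pCoord_cab k (a := 1) (b := 3) (c := u₃) (by norm_num) (by omega), pCoord_aba k 3 u₂]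
    ring
  · have h4 : 3 < u₁ := by omega
    simp only [e1, e2, e3, or_self, if_false]
    rw [pCoord_bca k (a := u₁) (b := u₂) (c := u₃) h12 h23, h123,
      pCoord_bca k (a := 1) (b := u₂) (c := u₃) (by omega) h23, pCoord_cab k (a := 2) (b := 3) (c := u₁) (by norm_num) h4,
      pCoord_bca k (a := 2) (b := u₂) (c := u₃) (by omega) h23, pCoord_cab k (a := 1) (b := 3) (c := u₁) (by norm_num) h4,
      pCoord_bca k (a := 3) (b := u₂) (c := u₃) h3 h23, pCoord_cab k (a := 1) (b := 2) (c := u₁) (by norm_num) (by omega)]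
    ring

/-! ## §4 Remark 3.10 and Example 3.2 as typed -/

/-- **`Rem3_10` HOLDS**: for `3 < a < b < c` the explicit `F_{(123),abc}` is `F_{(bc),(a123)}` («the one we used in this paper is
F_{m,(abc,a)}»).
[cite: Hu2025, (keyTrick) = (3.6)–(3.8) p.36 l.7–38; Ex. 3.2 p.34 l.23–27; Rem. 3.10 p.40 l.48–60 (unrefereed preprint arXiv:2507.21400v1 under adjudication, D-0012/D-0089
— kernel support on OUR typed carriers of row 101; nothing of the source asserted)] -/
theorem Rem3_10_holds : Rem3_10 n k := by
  intro u h4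
  obtain ⟨⟨a, b, c⟩, hu⟩ := u
  simp only at h4
  have hu' := hu
  unfold plIndexSet at hu'
  simp only [Finset.mem_filter, Finset.mem_product, Finset.mem_Icc] at hu'
  obtain ⟨-, hab, hbc⟩ := hu'
  have hlt : IsLt (a, b, c) := by
    unfold IsLt triSet mSet
    have hsub : ({b, c} : Finset ℕ) ⊆ ({a, b, c} : Finset ℕ) \ {1, 2, 3} := by
      intro x hx
      simp only [Finset.mem_insert, Finset.mem_singleton] at hx
      simp only [Finset.mem_sdiff, Finset.mem_insert, Finset.mem_singleton, not_or]
      omega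
    have hbc' : ({b, c} : Finset ℕ).card = 2 := by
      rw [Finset.card_insert_of_notMem (by simp; omega), Finset.card_singleton]
    have hle := Finset.card_le_card hsub
    rw [hbc'] at hle
    exact hle
  have h := C17L116_ours_holds (n := n) k ⟨(a, b, c), hu⟩ hlt
  rw [← h]
  unfold keyTrickRel_ours mSet
  simp only [Finset.mem_insert, Finset.mem_singleton]
  rw [if_neg (by omega)]

/-- **`Ex3_2` HOLDS**: `rk F_{(16),(3456)} = 0`, `rk F_{(12),(3456)} = 1`.
[cite: Hu2025, (keyTrick) = (3.6)–(3.8) p.36 l.7–38; Ex. 3.2 p.34 l.23–27; Rem. 3.10 p.40 l.48–60 (unrefereed preprint arXiv:2507.21400v1 under adjudication, D-0012/D-0089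
— kernel support on OUR typed carriers of row 101; nothing of the source asserted)] -/
theorem Ex3_2_holds : Ex3_2 := by
  unfold Ex3_2; decide

end Literature.AlgebraicGeometry.Hu2025.Statements.S03Pluecker

end
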